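import Mathlib
import Literature.Probability.LatticeModels.ConformalCovariance

/-! # Runbook sanity module (pub-ising3d REVIEW-RUNBOOK): the invariance predicates on correlation families

Non-vacuity witnesses for the definition cards `IsTranslationInvariant` / `IsRotationInvariant`
(`Literature.Probability.LatticeModels.ConformalCovariance`): each predicate HOLDS for an explicit family
and FAILS for another, and the two are independent (one family has each property without the other).
Ops-runbook seat, 2026-08-21; no new definitions of notions, only three explicit test families. -/

namespace Summit.CriticalPhenomena.Ising3D.Runbook

open Literature.Probability.LatticeModels
open scoped RealInnerProductSpace

noncomputable section

variable (d : ℕ)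

/-- Test family 1: the sum of all pairwise distances `∑ᵢ ∑ⱼ ‖xᵢ - xⱼ‖`. -/
def pairDistFamily : CorrFamily d := fun _ x => ∑ i, ∑ j, ‖x i - x j‖

/-- Test family 2: the sum of the norms `∑ᵢ ‖xᵢ‖` (sees the origin). -/
def normSumFamily : CorrFamily d := fun _ x => ∑ i, ‖x i‖

/-- Test family 3: the component of `x₀ - x₁` along a fixed vector `w` (zero on fewer than two points). -/
def projDiffFamily (w : EuclideanSpace ℝ (Fin d)) : CorrFamily d :=
  fun n x => if h : 2 ≤ n then ⟪x ⟨0, by omega⟩ - x ⟨1, by omega⟩, w⟫ else 0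

/-- HOLDS: pairwise distances are translation invariant. -/
theorem pairDistFamily_isTranslationInvariant : IsTranslationInvariant (pairDistFamily d) := by
  intro n v x
  simp [pairDistFamily]

/-- HOLDS: pairwise distances are rotation (linear-isometry) invariant. -/
theorem pairDistFamily_isRotationInvariant : IsRotationInvariant (pairDistFamily d) := by
  intro n R x
  simp only [pairDistFamily]
  refine Finset.sum_congr rfl fun i _ => Finset.sum_congr rfl fun j _ => ?_
  rw [← map_sub, LinearIsometryEquiv.norm_map]

/-- HOLDS: the norm sum is rotation invariant (linear isometries fix the origin). -/
theorem normSumFamily_isRotationInvariant : IsRotationInvariant (normSumFamily d) := by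
  intro n R x
  simp [normSumFamily]

/-- FAILS: the norm sum is NOT translation invariant as soon as `d ≥ 1`
(one point at the origin, translated by a unit vector). -/
theorem normSumFamily_not_isTranslationInvariant (hd : 0 < d) : ¬ IsTranslationInvariant (normSumFamily d) := by
  intro h
  have h1 := h 1 (EuclideanSpace.single (⟨0, hd⟩ : Fin d) (1 : ℝ)) (fun _ => 0)
  simp [normSumFamily] at h1

/-- HOLDS: the projected difference `⟪x₀ - x₁, w⟫` is translation invariant. -/
theorem projDiffFamily_isTranslationInvariant (w : EuclideanSpace ℝ (Fin d)) :
    IsTranslationInvariant (projDiffFamily d w) := by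
  intro n v x
  by_cases hn : 2 ≤ n
  · simp [projDiffFamily, hn]
  · simp [projDiffFamily, hn]

/-- FAILS: the projected difference along a unit vector `w` is NOT rotation invariant (`d ≥ 1`):
the isometry `x ↦ -x` flips its sign at `x₀ = w`, `x₁ = 0`. So translation invariance does not
imply rotation invariance (and `normSumFamily` shows the converse failure). -/
theorem projDiffFamily_not_isRotationInvariant (hd : 0 < d) :
    ¬ IsRotationInvariant (projDiffFamily d (EuclideanSpace.single (⟨0, hd⟩ : Fin d) (1 : ℝ))) := by
  intro h
  set w : EuclideanSpace ℝ (Fin d) := EuclideanSpace.single (⟨0, hd⟩ : Fin d) (1 : ℝ) with hw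
  have hww : ⟪w, w⟫ = (1 : ℝ) := by
    rw [hw, EuclideanSpace.inner_single_left]; simp
  have h1 := h 2 (LinearIsometryEquiv.neg ℝ) (fun i => if (i : ℕ) = 0 then w else 0)
  simp only [projDiffFamily, le_refl, dif_pos, LinearIsometryEquiv.coe_neg] at h1
  simp only [↓reduceIte, one_ne_zero, neg_zero, sub_zero, inner_neg_left] at h1
  rw [hww] at h1
  norm_num at h1

/-- Summary for the cards: both predicates are satisfiable and refutable, and independent. -/
theorem invariance_predicates_independent (hd : 0 < d) :
    (∃ S : CorrFamily d, IsTranslationInvariant S ∧ IsRotationInvariant S) ∧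
    (∃ S : CorrFamily d, IsRotationInvariant S ∧ ¬ IsTranslationInvariant S) ∧
    (∃ S : CorrFamily d, IsTranslationInvariant S ∧ ¬ IsRotationInvariant S) :=
  ⟨⟨_, pairDistFamily_isTranslationInvariant d, pairDistFamily_isRotationInvariant d⟩,
   ⟨_, normSumFamily_isRotationInvariant d, normSumFamily_not_isTranslationInvariant d hd⟩,
   ⟨_, projDiffFamily_isTranslationInvariant d _, projDiffFamily_not_isRotationInvariant d hd⟩⟩

end

end Summit.CriticalPhenomena.Ising3D.Runbook
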